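import Literature.NumberTheory.Sieve.GoldstonPintzYildirimLemma3Inner
import HarnessLib

/-!
# Goldston–Pintz–Yıldırım, Lemma 3 — the outer stage in the `s₂`-plane

Trunk: NumberTheory / Sieve, continuing `GoldstonPintzYildirimLemma3Inner` (GPY, *Primes in
tuples I*, §8). After the inner decomposition, the outer integral over `Re s₂ = θ₂` meets two
functions of `s₂` alone: `ρ₀(s₂) = ∮_{∂Q(0,η)} F(s₁,s₂) ds₁` (the residue at `s₁ = 0`, carrying
the factor `R^{s₂}`; GPY's (8.9)) and the diagonal term `r(s₂)` (GPY's (8.20)–(8.23)). This file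
proves that both are holomorphic in `s₂` (rectangle-boundary integrals depending holomorphically on
a parameter, `Literature.Analysis.Complex.differentiableOn_rectBoundaryIntegral`) and performs the
second contour move: `ρ₀` is shifted from `Re s₂ = θ₂` to `Re s₂ = −σ₀` across its pole at
`s₂ = 0`, isolated in the square `Q(0,η′)`, `η′ = 3η` (Cauchy's theorem for a rectangular annulus),
which leaves the double square integral `∮_{∂Q(0,η′)} ∮_{∂Q(0,η)} F ds₁ ds₂` — the iterated residue
`I₀` of (8.8) in Motohashi's form (GPY, remark after (8.13)). Everything here is PROVED:

* `differentiableAt_lemma3F_prod` — the integrand is jointly holomorphic on the good set;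
* `differentiableOn_zeroRes` — `ρ₀` is holomorphic on
  `{Re s₂ > −1/4, W(s₂) ≠ 0, ‖s₂‖_∞ > η}`;
* `differentiableOn_diagRes` — `r` is holomorphic on the box `θlo < Re s₂ < Y`, `|Im s₂| < Y′`
  (`2η ≤ θlo`), given the zero-free region at depth `η + Y` and height `η + Y′`;
* `integral_zeroRes_segment_eq` — **the outer decomposition**:
  `I ∫_{−T}^{T} ρ₀(θ₂+it) dt = ∮_{∂Q(0,η′)} ρ₀ − ∫_bot + ∫_top + I ∫_left` on the rectangle
  `[−σ₀, θ₂] × [−T, T]`;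
* the **main term**: `modelKernel` `K = e^{L(s₁+s₂)}/(s₁^{u+1}s₂^{v+1}(s₁+s₂)^d)`,
  `lemma3F_eq_lemma3D_mul_modelKernel` (`F = D·K`), `modelInner` (`A(s₂) = ∮ K(·,s₂)`, closed form
  `modelInner_eq` and `continuousAt_modelInner` from `Literature.Analysis.Complex.DoubleContourExpModel`),
  `pertInner` (`P(s₂) = ∮ (F − D(0,0)K)(·,s₂)`), `zeroRes_eq_add` (`ρ₀ = D(0,0) A + P`),
  `rectBoundaryIntegral_zeroRes_eq` —
  `∮_{∂Q(0,η′)} ρ₀ = D(0,0)·(2πi)² C(u+v,u) (log R)^{u+v+d}/(u+v+d)! + ∮_{∂Q(0,η′)} P` (GPY (8.13));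
* the **perturbation**: `norm_lemma3D_sub_zero_le` — `|D(s₁,s₂) − D(0,0)| ≤ (M_D/ρ)(|s₁|+|s₂|)` by
  Cauchy's estimate on circles of radius `ρ` and the mean value inequality (`M_D = B(3/2)^d 2^{a+b}`),
  and `norm_rectBoundaryIntegral_pertInner_le` —
  `|∮ P| ≤ 8η′·8η·(M_D/ρ)(2η+2η′) e^{L(η+η′)}/(η^{u+1}η′^{v+1}(η′−2η)^d)`.

## References

* D. A. Goldston, J. Pintz, C. Y. Yıldırım, *Primes in tuples. I*, Ann. of Math. (2) 170 (2009),
  819–862 = arXiv:math/0508185, §8, (8.7)–(8.9), (8.13) and the remark following it, (8.20)–(8.23).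
  [cite: GoldstonPintzYildirim2009]
-/

noncomputable section

open Complex Filter Topology MeasureTheory Set intervalIntegral
open scoped Real Interval

namespace Literature.NumberTheory.Sieve.GPY

open Literature.Analysis.Complex (rectBoundaryIntegral)
open Literature.NumberTheory.LFunctions.Nicolas (zetaOne zetaOne_zero differentiable_zetaOne zetaOne_of_ne_zero)

section Outer

variable {G : ℂ → ℂ → ℂ} {cbar C : ℝ}

/-! ### Joint holomorphy of the integrand -/

/-- **The integrand is jointly holomorphic** (as a map on `ℂ × ℂ`) at every point of the good set.
[cite: GoldstonPintzYildirim2009, Section 8 eq. 8.1] -/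
theorem differentiableAt_lemma3F_prod (hG : DifferentiableOn ℂ (fun z : ℂ × ℂ => G z.1 z.2) G₂Region)
    {R : ℝ} (hR : 0 < R) (a b d u v : ℕ) {z : ℂ × ℂ} (hz : z ∈ lemma3Good) :
    DifferentiableAt ℂ (fun z : ℂ × ℂ => lemma3F G R a b d u v z.1 z.2) z := by
  obtain ⟨h1, h2, hW1, hW2, hs1, hs2, hs12⟩ := hz
  have hGd : DifferentiableAt ℂ (fun z : ℂ × ℂ => G z.1 z.2) z :=
    hG.differentiableAt (isOpen_G₂Region.mem_nhds ⟨h1, h2⟩)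
  have hW : Differentiable ℂ zetaOne := differentiable_zetaOne
  have hfst : DifferentiableAt ℂ (fun z : ℂ × ℂ => z.1) z := differentiableAt_fst
  have hsnd : DifferentiableAt ℂ (fun z : ℂ × ℂ => z.2) z := differentiableAt_snd
  have hsum : DifferentiableAt ℂ (fun z : ℂ × ℂ => z.1 + z.2) z := hfst.add hsnd
  have hW12 : DifferentiableAt ℂ (fun z : ℂ × ℂ => zetaOne (z.1 + z.2)) z := (hW _).comp z hsum
  have hW1d : DifferentiableAt ℂ (fun z : ℂ × ℂ => zetaOne z.1) z := (hW _).comp z hfst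
  have hW2d : DifferentiableAt ℂ (fun z : ℂ × ℂ => zetaOne z.2) z := (hW _).comp z hsnd
  have hRd : DifferentiableAt ℂ (fun z : ℂ × ℂ => (R : ℂ) ^ (z.1 + z.2)) z :=
    hsum.const_cpow (Or.inl (by exact_mod_cast hR.ne'))
  -- quotients as products with inverses (`DifferentiableAt.inv` works on any domain)
  have hWinv : DifferentiableAt ℂ (fun z : ℂ × ℂ => (zetaOne z.1 ^ a * zetaOne z.2 ^ b)⁻¹) z :=
    ((hW1d.pow a).mul (hW2d.pow b)).inv (mul_ne_zero (pow_ne_zero _ hW1) (pow_ne_zero _ hW2))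
  have hden : DifferentiableAt ℂ (fun z : ℂ × ℂ => (z.1 ^ (u + 1) * z.2 ^ (v + 1) * (z.1 + z.2) ^ d)⁻¹) z :=
    (((hfst.pow _).mul (hsnd.pow _)).mul (hsum.pow _)).inv
      (mul_ne_zero (mul_ne_zero (pow_ne_zero _ hs1) (pow_ne_zero _ hs2)) (pow_ne_zero _ hs12))
  have h : DifferentiableAt ℂ (fun z : ℂ × ℂ =>
      G z.1 z.2 * zetaOne (z.1 + z.2) ^ d * (zetaOne z.1 ^ a * zetaOne z.2 ^ b)⁻¹ * (R : ℂ) ^ (z.1 + z.2) *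
        (z.1 ^ (u + 1) * z.2 ^ (v + 1) * (z.1 + z.2) ^ d)⁻¹) z :=
    (((hGd.mul (hW12.pow d)).mul hWinv).mul hRd).mul hden
  have heq : (fun z : ℂ × ℂ => lemma3F G R a b d u v z.1 z.2) = (fun z : ℂ × ℂ =>
      G z.1 z.2 * zetaOne (z.1 + z.2) ^ d * (zetaOne z.1 ^ a * zetaOne z.2 ^ b)⁻¹ * (R : ℂ) ^ (z.1 + z.2) *
        (z.1 ^ (u + 1) * z.2 ^ (v + 1) * (z.1 + z.2) ^ d)⁻¹) := by
    funext z
    simp only [lemma3F, lemma3D, div_eq_mul_inv]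
  rw [heq]
  exact h

/-! ### Holomorphy of `ρ₀` -/

/-- The domain of holomorphy of `ρ₀`: `Re s₂ > −1/4`, `W(s₂) ≠ 0`, and `s₂` outside the closed
square `[−η, η]²` in the sup-norm sense (so that `s₁ + s₂ ≠ 0` and `s₂ ≠ 0` for `s₁ ∈ ∂Q(0,η)`).
[cite: GoldstonPintzYildirim2009, Section 8 eq. 8.9] -/
def zeroResDomain (η : ℝ) : Set ℂ :=
  {s₂ | -1 / 4 < s₂.re ∧ zetaOne s₂ ≠ 0 ∧ (η < |s₂.re| ∨ η < |s₂.im|)}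

/-- `zeroResDomain η` is open. [folklore] -/
theorem isOpen_zeroResDomain (η : ℝ) : IsOpen (zeroResDomain η) := by
  have hW : Continuous zetaOne := differentiable_zetaOne.continuous
  refine (isOpen_lt continuous_const Complex.continuous_re).inter
    ((isOpen_ne_fun hW continuous_const).inter ?_)
  exact (isOpen_lt continuous_const (continuous_abs.comp Complex.continuous_re)).union
    (isOpen_lt continuous_const (continuous_abs.comp Complex.continuous_im))

/-- A thickened boundary of the square `Q(0,η)`: `|Re s₁|, |Im s₁| ≤ η` and
`(η/2 < |Re s₁| ∨ η/2 < |Im s₁|)` (so `s₁ ≠ 0`, `‖s₁‖ ≤ 2η`). [folklore] -/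
def squareShell (η : ℝ) : Set ℂ :=
  {s₁ | |s₁.re| ≤ η ∧ |s₁.im| ≤ η ∧ (η / 2 < |s₁.re| ∨ η / 2 < |s₁.im|)}

/-- For `s₂ ∈ zeroResDomain η` and `s₁ ∈ squareShell η` (`0 < η < 1/8`, `2η ≤ ρ_W`), the point
`(s₁, s₂)` is good. [folklore] -/
theorem mem_lemma3Good_of_shell {ρW η : ℝ} (hρ : ∀ s : ℂ, ‖s‖ ≤ ρW → 1 / 2 ≤ ‖zetaOne s‖ ∧ ‖zetaOne s‖ ≤ 3 / 2)
    (hη : 0 < η) (hη8 : η < 1 / 8) (hηρ : 2 * η ≤ ρW) {s₁ s₂ : ℂ} (hs₁ : s₁ ∈ squareShell η)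
    (hs₂ : s₂ ∈ zeroResDomain η) : (s₁, s₂) ∈ lemma3Good := by
  obtain ⟨hr1, hi1, hor1⟩ := hs₁
  obtain ⟨hre2, hW2, hor2⟩ := hs₂
  have hn1 : ‖s₁‖ ≤ 2 * η := by
    have := Complex.norm_le_abs_re_add_abs_im s₁; linarith
  have hW1 : zetaOne s₁ ≠ 0 := by
    have := (hρ s₁ (hn1.trans hηρ)).1
    intro h; rw [h, norm_zero] at this; linarith
  have hs1ne : s₁ ≠ 0 := by
    intro h; rw [h] at hor1; simp at hor1; linarith
  have hs2ne : s₂ ≠ 0 := by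
    intro h; rw [h] at hor2; simp at hor2; linarith
  have hs12 : s₁ + s₂ ≠ 0 := by
    intro h
    have hre : s₁.re + s₂.re = 0 := by have := congrArg Complex.re h; simpa using this
    have him : s₁.im + s₂.im = 0 := by have := congrArg Complex.im h; simpa using this
    rcases hor2 with h2 | h2
    · have : |s₂.re| = |s₁.re| := by rw [show s₂.re = -s₁.re by linarith, abs_neg]
      linarith [abs_le.1 hr1]
    · have : |s₂.im| = |s₁.im| := by rw [show s₂.im = -s₁.im by linarith, abs_neg]
      linarith [abs_le.1 hi1]
  have hre1 : -1 / 4 < s₁.re := by linarith [(abs_le.1 hr1).1]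
  exact ⟨hre1, hre2, hW1, hW2, hs1ne, hs2ne, hs12⟩

/-- **`ρ₀` is holomorphic** on `zeroResDomain η` (`0 < η < 1/8`, `2η ≤ ρ_W`, `R > 0`).
[cite: GoldstonPintzYildirim2009, Section 8 eq. 8.9] -/
theorem differentiableOn_zeroRes (hG : DifferentiableOn ℂ (fun z : ℂ × ℂ => G z.1 z.2) G₂Region)
    {ρW : ℝ} (hρ : ∀ s : ℂ, ‖s‖ ≤ ρW → 1 / 2 ≤ ‖zetaOne s‖ ∧ ‖zetaOne s‖ ≤ 3 / 2)
    {R : ℝ} (hR : 0 < R) (a b d u v : ℕ) {η : ℝ} (hη : 0 < η) (hη8 : η < 1 / 8) (hηρ : 2 * η ≤ ρW) :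
    DifferentiableOn ℂ (zeroRes G R a b d u v η) (zeroResDomain η) := by
  unfold zeroRes
  refine Literature.Analysis.Complex.differentiableOn_rectBoundaryIntegral (F := fun p z => lemma3F G R a b d u v z p)
    (S := squareShell η) (isOpen_zeroResDomain η) (by linarith) (by linarith) ?_ ?_ ?_
  · -- boundary points lie in the shell
    rintro z (⟨hre, him | him⟩ | ⟨him, hre | hre⟩)
    · exact ⟨abs_le.2 ⟨hre.1, hre.2⟩, by rw [him, abs_neg, abs_of_pos hη],
        Or.inr (by rw [him, abs_neg, abs_of_pos hη]; linarith)⟩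
    · exact ⟨abs_le.2 ⟨hre.1, hre.2⟩, by rw [him, abs_of_pos hη],
        Or.inr (by rw [him, abs_of_pos hη]; linarith)⟩
    · exact ⟨by rw [hre, abs_neg, abs_of_pos hη], abs_le.2 ⟨him.1, him.2⟩,
        Or.inl (by rw [hre, abs_neg, abs_of_pos hη]; linarith)⟩
    · exact ⟨by rw [hre, abs_of_pos hη], abs_le.2 ⟨him.1, him.2⟩,
        Or.inl (by rw [hre, abs_of_pos hη]; linarith)⟩
  · -- differentiability in the parameter
    intro s₁ hs₁ s₂ hs₂
    obtain ⟨h1, h2, hW1, hW2, hs1ne, hs2ne, hs12⟩ := mem_lemma3Good_of_shell hρ hη hη8 hηρ hs₁ hs₂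
    exact (differentiableAt_lemma3F_snd hG hR a b d u v h1 h2 hW1 hW2 hs1ne hs2ne hs12).differentiableWithinAt
  · -- joint continuity on `U × S` (pointwise, from joint holomorphy at good points)
    intro q hq
    have hz : (q.2, q.1) ∈ lemma3Good := mem_lemma3Good_of_shell hρ hη hη8 hηρ hq.2 hq.1
    have h1 : ContinuousAt (fun z : ℂ × ℂ => lemma3F G R a b d u v z.1 z.2) (q.2, q.1) :=
      (differentiableAt_lemma3F_prod hG hR a b d u v hz).continuousAt
    have h2 : ContinuousAt (fun q : ℂ × ℂ => (q.2, q.1)) q := continuous_swap.continuousAt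
    have h3 : ContinuousAt (fun q : ℂ × ℂ => lemma3F G R a b d u v q.2 q.1) q :=
      ContinuousAt.comp (f := fun q : ℂ × ℂ => (q.2, q.1)) h1 h2
    exact h3.continuousWithinAt

/-! ### Holomorphy of the diagonal term `r` -/

/-- **`r` is holomorphic** on the open box `θlo < Re s₂ < Y`, `|Im s₂| < Y'` (any `θlo` with
`2η ≤ θlo`), provided `η + Y < 1/4` and the zero-free region holds at depth `η + Y` up to height
`η + Y'` (`η + Y ≤ 4c̄/log(η + Y' + 3)`): for `w ∈ ∂Q(0,η)` the point `s₁ = w − s₂` has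
`Re s₁ ≤ η − θlo < 0` and `W(s₁) ≠ 0`. [cite: GoldstonPintzYildirim2009, Section 8 eq. 8.21] -/
theorem differentiableOn_diagRes
    (hWz : ∀ z : ℂ, z ≠ 0 → -(4 * cbar / Real.log (|z.im| + 3)) ≤ z.re → zetaOne z ≠ 0)
    (hc : 0 ≤ cbar) (hG : DifferentiableOn ℂ (fun z : ℂ × ℂ => G z.1 z.2) G₂Region)
    {R : ℝ} (hR : 0 < R) (a b d u v : ℕ) {η θlo Y Y' : ℝ} (hη : 0 < η) (hθlo : 2 * η ≤ θlo)
    (hquarter : η + Y < 1 / 4) (hzfr : η + Y ≤ 4 * cbar / Real.log (η + Y' + 3)) :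
    DifferentiableOn ℂ (diagRes G R a b d u v η) {s₂ : ℂ | θlo < s₂.re ∧ s₂.re < Y ∧ |s₂.im| < Y'} := by
  unfold diagRes lemma3g
  have hUo : IsOpen {s₂ : ℂ | θlo < s₂.re ∧ s₂.re < Y ∧ |s₂.im| < Y'} :=
    (isOpen_lt continuous_const Complex.continuous_re).inter
      ((isOpen_lt Complex.continuous_re continuous_const).inter
        (isOpen_lt (continuous_abs.comp Complex.continuous_im) continuous_const))
  -- good points: `w` in the closed square shell, `s₂` in the box
  have hgood : ∀ w : ℂ, |w.re| ≤ η → |w.im| ≤ η → (η / 2 < |w.re| ∨ η / 2 < |w.im|) →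
      ∀ s₂ : ℂ, θlo < s₂.re → s₂.re < Y → |s₂.im| < Y' → (w - s₂, s₂) ∈ lemma3Good := by
    intro w hwr hwi hwor s₂ h1 h2 h3
    have hwr' := abs_le.1 hwr
    have hwi' := abs_le.1 hwi
    have h3' := abs_lt.1 h3
    have hs2re : 0 < s₂.re := by linarith
    have hs2ne : s₂ ≠ 0 := fun h => by rw [h] at hs2re; simp at hs2re
    have hs1re : (w - s₂).re < 0 := by simp only [sub_re]; linarith
    have hs1ne : w - s₂ ≠ 0 := fun h => by rw [h] at hs1re; simp at hs1re
    have hw0 : w ≠ 0 := by intro h; rw [h] at hwor; simp at hwor; linarith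
    have hW1 : zetaOne (w - s₂) ≠ 0 := by
      refine hWz _ hs1ne (region_of_height_le hc (Y := η + Y') ?_ ?_)
      · simp only [sub_im]
        calc |w.im - s₂.im| ≤ |w.im| + |s₂.im| := abs_sub _ _
          _ ≤ η + Y' := by linarith
      · simp only [sub_re]; linarith
    have hW2 : zetaOne s₂ ≠ 0 := zetaOne_ne_zero_of_re_pos hs2re
    refine ⟨by simp only [sub_re]; linarith, by linarith, hW1, hW2, hs1ne, hs2ne, ?_⟩
    rw [sub_add_cancel]; exact hw0
  refine Literature.Analysis.Complex.differentiableOn_rectBoundaryIntegral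
    (F := fun p w => lemma3F G R a b d u v (w - p) p) (S := squareShell η) hUo (by linarith) (by linarith) ?_ ?_ ?_
  · rintro z (⟨hre, him | him⟩ | ⟨him, hre | hre⟩)
    · exact ⟨abs_le.2 ⟨hre.1, hre.2⟩, by rw [him, abs_neg, abs_of_pos hη],
        Or.inr (by rw [him, abs_neg, abs_of_pos hη]; linarith)⟩
    · exact ⟨abs_le.2 ⟨hre.1, hre.2⟩, by rw [him, abs_of_pos hη],
        Or.inr (by rw [him, abs_of_pos hη]; linarith)⟩
    · exact ⟨by rw [hre, abs_neg, abs_of_pos hη], abs_le.2 ⟨him.1, him.2⟩,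
        Or.inl (by rw [hre, abs_neg, abs_of_pos hη]; linarith)⟩
    · exact ⟨by rw [hre, abs_of_pos hη], abs_le.2 ⟨him.1, him.2⟩,
        Or.inl (by rw [hre, abs_of_pos hη]; linarith)⟩
  · intro w hw s₂ hs₂
    obtain ⟨hwr, hwi, hwor⟩ := hw
    have hz := hgood w hwr hwi hwor s₂ hs₂.1 hs₂.2.1 hs₂.2.2
    have hF := differentiableAt_lemma3F_prod hG hR a b d u v hz
    have hi : DifferentiableAt ℂ (fun p : ℂ => (w - p, p)) s₂ :=
      ((differentiableAt_const w).sub differentiableAt_id).prodMk differentiableAt_id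
    have h3 : DifferentiableAt ℂ (fun p : ℂ => lemma3F G R a b d u v (w - p) p) s₂ :=
      DifferentiableAt.comp (f := fun p : ℂ => (w - p, p)) s₂ hF hi
    exact h3.differentiableWithinAt
  · intro q hq
    have hz : (q.2 - q.1, q.1) ∈ lemma3Good :=
      hgood q.2 hq.2.1 hq.2.2.1 hq.2.2.2 q.1 hq.1.1 hq.1.2.1 hq.1.2.2
    have h1 : ContinuousAt (fun z : ℂ × ℂ => lemma3F G R a b d u v z.1 z.2) (q.2 - q.1, q.1) :=
      (differentiableAt_lemma3F_prod hG hR a b d u v hz).continuousAt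
    have h2 : ContinuousAt (fun q : ℂ × ℂ => (q.2 - q.1, q.1)) q := by fun_prop
    have h3 : ContinuousAt (fun q : ℂ × ℂ => lemma3F G R a b d u v (q.2 - q.1) q.1) q :=
      ContinuousAt.comp (f := fun q : ℂ × ℂ => (q.2 - q.1, q.1)) h1 h2
    exact h3.continuousWithinAt

/-! ### The outer decomposition for `ρ₀` -/

/-- **The outer decomposition**: on the rectangle `[−σ₀, θ₂] × [−T, T]` of the `s₂`-plane with the
square `Q(0,η′)` removed (`η < η′ < θ₂`, `η′ < σ₀`, `η′ ≤ T`), `ρ₀` is holomorphic (zero-free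
region at depth `σ₀` and height `T`: `σ₀ ≤ 4c̄/log(T+3)`, `σ₀ < 1/4`), so
`I ∫_{−T}^{T} ρ₀(θ₂+it) dt = ∮_{∂Q(0,η′)} ρ₀ − ∫_{−σ₀}^{θ₂} ρ₀(x − iT)dx + ∫_{−σ₀}^{θ₂} ρ₀(x + iT)dx + I ∫_{−T}^{T} ρ₀(−σ₀+it)dt`.
[cite: GoldstonPintzYildirim2009, Section 8 eq. 8.8] -/
theorem integral_zeroRes_segment_eq
    (hWz : ∀ z : ℂ, z ≠ 0 → -(4 * cbar / Real.log (|z.im| + 3)) ≤ z.re → zetaOne z ≠ 0)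
    (hc : 0 ≤ cbar) (hG : DifferentiableOn ℂ (fun z : ℂ × ℂ => G z.1 z.2) G₂Region)
    {ρW : ℝ} (hρ : ∀ s : ℂ, ‖s‖ ≤ ρW → 1 / 2 ≤ ‖zetaOne s‖ ∧ ‖zetaOne s‖ ≤ 3 / 2)
    {R : ℝ} (hR : 0 < R) (a b d u v : ℕ) {η η' θ₂ σ₀ T : ℝ} (hη : 0 < η) (hη8 : η < 1 / 8)
    (hηρ : 2 * η ≤ ρW) (hηη' : η < η') (hη'θ : η' < θ₂) (hη'σ : η' < σ₀) (hη'T : η' ≤ T)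
    (hσ₀ : σ₀ < 1 / 4) (hzfr : σ₀ ≤ 4 * cbar / Real.log (T + 3)) :
    I * (∫ t : ℝ in (-T)..T, zeroRes G R a b d u v η ((θ₂ : ℂ) + t * I)) =
      rectBoundaryIntegral (zeroRes G R a b d u v η) (-η') η' (-η') η' -
        (∫ x : ℝ in (-σ₀)..θ₂, zeroRes G R a b d u v η ((x : ℂ) + ((-T : ℝ) : ℂ) * I)) +
        (∫ x : ℝ in (-σ₀)..θ₂, zeroRes G R a b d u v η ((x : ℂ) + (T : ℂ) * I)) +
        I * ∫ t : ℝ in (-T)..T, zeroRes G R a b d u v η (((-σ₀ : ℝ) : ℂ) + t * I) := by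
  have hdiffU := differentiableOn_zeroRes hG hρ hR a b d u v hη hη8 hηρ
  -- the annular region lies in `zeroResDomain η`
  have hsub : (Icc (-σ₀) θ₂ ×ℂ Icc (-T) T) \ (Ioo (-η') η' ×ℂ Ioo (-η') η') ⊆ zeroResDomain η := by
    rintro s₂ ⟨⟨hre, him⟩, hout⟩
    have hmax : η < |s₂.re| ∨ η < |s₂.im| := by
      by_contra hcon
      push Not at hcon
      obtain ⟨h1, h2⟩ := hcon
      apply hout
      have h1' := abs_le.1 h1
      have h2' := abs_le.1 h2
      exact ⟨⟨by linarith, by linarith⟩, ⟨by linarith, by linarith⟩⟩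
    have hs2ne : s₂ ≠ 0 := by intro h; rw [h] at hmax; simp at hmax; linarith
    have hW2 : zetaOne s₂ ≠ 0 := hWz s₂ hs2ne (region_of_height_le hc (Y := T)
      (abs_le.2 ⟨him.1, him.2⟩) (by linarith [hre.1]))
    exact ⟨by linarith [hre.1], hW2, hmax⟩
  have hann := Literature.Analysis.Complex.rectBoundaryIntegral_eq_of_differentiableOn_annulus
    (F := zeroRes G R a b d u v η) (a := -σ₀) (b := θ₂) (c := -T) (d := T)
    (a' := -η') (b' := η') (c' := -η') (d' := η')
    (by linarith) (by linarith) (by linarith) (by linarith) (by linarith) hη'T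
    (fun s₂ hs₂ => (hdiffU s₂ (hsub hs₂)).mono hsub)
  rw [Literature.Analysis.Complex.rectBoundaryIntegral] at hann
  linear_combination hann

/-! ### The model kernel and the factorisation `F = D · K` -/

/-- The model kernel `K(s₁,s₂) = e^{L(s₁+s₂)} / (s₁^{u+1} s₂^{v+1} (s₁+s₂)^d)` of GPY's `I₀`
(with `L = log R`). [cite: GoldstonPintzYildirim2009, Section 8 eq. 8.13] -/
def modelKernel (L : ℂ) (d u v : ℕ) (s₁ s₂ : ℂ) : ℂ :=
  cexp (L * (s₁ + s₂)) / (s₁ ^ (u + 1) * s₂ ^ (v + 1) * (s₁ + s₂) ^ d)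

/-- `F(s₁,s₂) = D(s₁,s₂) · K(s₁,s₂)` (`R > 0`, `R^{s} = e^{s log R}`).
[cite: GoldstonPintzYildirim2009, Section 8 eq. 8.1] -/
theorem lemma3F_eq_lemma3D_mul_modelKernel {R : ℝ} (hR : 0 < R) (a b d u v : ℕ) (s₁ s₂ : ℂ) :
    lemma3F G R a b d u v s₁ s₂ =
      lemma3D G a b d s₁ s₂ * modelKernel (Real.log R) d u v s₁ s₂ := by
  unfold lemma3F modelKernel
  rw [Complex.cpow_def_of_ne_zero (by exact_mod_cast hR.ne'), ← Complex.ofReal_log hR.le]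
  ring

/-! ### `D` is Lipschitz at the origin (Cauchy estimates) -/

/-- **Sup bound for `D` on a small bidisc**: if `|G| ≤ B` for `‖s₁‖, ‖s₂‖ ≤ 2ρ` and `4ρ ≤ ρ_W`
(`1/2 ≤ |W| ≤ 3/2` on `‖s‖ ≤ ρ_W`), then `|D(s₁,s₂)| ≤ B (3/2)^d 2^a 2^b` there.
[cite: GoldstonPintzYildirim2009, Section 8 eq. 8.3] -/
theorem norm_lemma3D_le_of_small {ρW ρ B : ℝ}
    (hρ : ∀ s : ℂ, ‖s‖ ≤ ρW → 1 / 2 ≤ ‖zetaOne s‖ ∧ ‖zetaOne s‖ ≤ 3 / 2) (h4ρ : 4 * ρ ≤ ρW) (hB0 : 0 ≤ B)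
    (hGB : ∀ s₁ s₂ : ℂ, ‖s₁‖ ≤ 2 * ρ → ‖s₂‖ ≤ 2 * ρ → ‖G s₁ s₂‖ ≤ B) (a b d : ℕ) {s₁ s₂ : ℂ}
    (h1 : ‖s₁‖ ≤ 2 * ρ) (h2 : ‖s₂‖ ≤ 2 * ρ) :
    ‖lemma3D G a b d s₁ s₂‖ ≤ B * (3 / 2) ^ d * 2 ^ a * 2 ^ b := by
  have hρ0 : 0 ≤ ρ := by linarith [norm_nonneg s₁]
  have h12 : ‖s₁ + s₂‖ ≤ ρW := (norm_add_le _ _).trans (by linarith)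
  have hW12 : ‖zetaOne (s₁ + s₂)‖ ≤ 3 / 2 := (hρ _ h12).2
  have hW1 : 1 / 2 ≤ ‖zetaOne s₁‖ := (hρ _ (by linarith)).1
  have hW2 : 1 / 2 ≤ ‖zetaOne s₂‖ := (hρ _ (by linarith)).1
  have hW1i : ‖(zetaOne s₁)⁻¹‖ ≤ 2 := by
    rw [norm_inv]; exact inv_le_of_inv_le₀ (by norm_num) (by linarith)
  have hW2i : ‖(zetaOne s₂)⁻¹‖ ≤ 2 := by
    rw [norm_inv]; exact inv_le_of_inv_le₀ (by norm_num) (by linarith)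
  have hG' := hGB s₁ s₂ h1 h2
  have hW10 : 0 < ‖zetaOne s₁‖ := by linarith
  have hW20 : 0 < ‖zetaOne s₂‖ := by linarith
  unfold lemma3D
  rw [norm_div, norm_mul, norm_mul, norm_pow, norm_pow, norm_pow, div_le_iff₀ (by positivity)]
  have e1 : ‖zetaOne (s₁ + s₂)‖ ^ d ≤ (3 / 2) ^ d := pow_le_pow_left₀ (norm_nonneg _) hW12 d
  have e2 : 1 ≤ (2 * ‖zetaOne s₁‖) ^ a := one_le_pow₀ (by linarith)
  have e3 : 1 ≤ (2 * ‖zetaOne s₂‖) ^ b := one_le_pow₀ (by linarith)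
  calc ‖G s₁ s₂‖ * ‖zetaOne (s₁ + s₂)‖ ^ d ≤ B * (3 / 2) ^ d * 1 * 1 := by
        rw [mul_one, mul_one]; exact mul_le_mul hG' e1 (by positivity) hB0
    _ ≤ B * (3 / 2) ^ d * (2 * ‖zetaOne s₁‖) ^ a * (2 * ‖zetaOne s₂‖) ^ b := by gcongr
    _ = B * (3 / 2) ^ d * 2 ^ a * 2 ^ b * (‖zetaOne s₁‖ ^ a * ‖zetaOne s₂‖ ^ b) := by
        rw [mul_pow, mul_pow]; ring

/-- `D(·, s₂)` is holomorphic on the ball `‖s₁‖ < 3ρ` when `‖s₂‖ < 3ρ`, `6ρ ≤ ρ_W`, `3ρ < 1/4`.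
[cite: GoldstonPintzYildirim2009, Section 8 eq. 8.3] -/
theorem differentiableOn_lemma3D_fst (hG : DifferentiableOn ℂ (fun z : ℂ × ℂ => G z.1 z.2) G₂Region)
    {ρW ρ : ℝ} (hρ : ∀ s : ℂ, ‖s‖ ≤ ρW → 1 / 2 ≤ ‖zetaOne s‖ ∧ ‖zetaOne s‖ ≤ 3 / 2)
    (h6ρ : 6 * ρ ≤ ρW) (hρ4 : 3 * ρ < 1 / 4) (a b d : ℕ) {s₂ : ℂ} (hs₂ : ‖s₂‖ < 3 * ρ) :
    DifferentiableOn ℂ (fun s₁ => lemma3D G a b d s₁ s₂) (Metric.ball 0 (3 * ρ)) := by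
  intro s₁ hs₁
  rw [Metric.mem_ball, dist_zero_right] at hs₁
  have hne : ∀ s : ℂ, ‖s‖ ≤ ρW → zetaOne s ≠ 0 := fun s hs h => by
    have := (hρ s hs).1; rw [h, norm_zero] at this; linarith
  have hW1 : zetaOne s₁ ≠ 0 := hne _ (by linarith [norm_nonneg s₁, norm_nonneg s₂])
  have hW2 : zetaOne s₂ ≠ 0 := hne _ (by linarith [norm_nonneg s₁, norm_nonneg s₂])
  have hre1 : -1 / 4 < s₁.re := by
    have := Complex.abs_re_le_norm s₁; have := neg_abs_le s₁.re; linarith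
  have hre2 : -1 / 4 < s₂.re := by
    have := Complex.abs_re_le_norm s₂; have := neg_abs_le s₂.re; linarith
  have hGd := differentiableAt_G_fst hG hre1 hre2
  have hW : Differentiable ℂ zetaOne := differentiable_zetaOne
  have h12 : DifferentiableAt ℂ (fun s₁ => zetaOne (s₁ + s₂)) s₁ :=
    (hW _).comp s₁ (differentiableAt_id.add_const s₂)
  unfold lemma3D
  refine ((hGd.mul (h12.pow d)).div (((hW s₁).pow a).mul ((differentiableAt_const _).pow b))
    ?_).differentiableWithinAt
  exact mul_ne_zero (pow_ne_zero _ hW1) (pow_ne_zero _ hW2)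

/-- `D(s₁, ·)` is holomorphic on the ball `‖s₂‖ < 3ρ` when `‖s₁‖ < 3ρ`, `6ρ ≤ ρ_W`, `3ρ < 1/4`.
[cite: GoldstonPintzYildirim2009, Section 8 eq. 8.3] -/
theorem differentiableOn_lemma3D_snd (hG : DifferentiableOn ℂ (fun z : ℂ × ℂ => G z.1 z.2) G₂Region)
    {ρW ρ : ℝ} (hρ : ∀ s : ℂ, ‖s‖ ≤ ρW → 1 / 2 ≤ ‖zetaOne s‖ ∧ ‖zetaOne s‖ ≤ 3 / 2)
    (h6ρ : 6 * ρ ≤ ρW) (hρ4 : 3 * ρ < 1 / 4) (a b d : ℕ) {s₁ : ℂ} (hs₁ : ‖s₁‖ < 3 * ρ) :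
    DifferentiableOn ℂ (fun s₂ => lemma3D G a b d s₁ s₂) (Metric.ball 0 (3 * ρ)) := by
  intro s₂ hs₂
  rw [Metric.mem_ball, dist_zero_right] at hs₂
  have hne : ∀ s : ℂ, ‖s‖ ≤ ρW → zetaOne s ≠ 0 := fun s hs h => by
    have := (hρ s hs).1; rw [h, norm_zero] at this; linarith
  have hW1 : zetaOne s₁ ≠ 0 := hne _ (by linarith [norm_nonneg s₁, norm_nonneg s₂])
  have hW2 : zetaOne s₂ ≠ 0 := hne _ (by linarith [norm_nonneg s₁, norm_nonneg s₂])
  have hre1 : -1 / 4 < s₁.re := by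
    have := Complex.abs_re_le_norm s₁; have := neg_abs_le s₁.re; linarith
  have hre2 : -1 / 4 < s₂.re := by
    have := Complex.abs_re_le_norm s₂; have := neg_abs_le s₂.re; linarith
  have hGd := differentiableAt_G_snd hG hre1 hre2
  have hW : Differentiable ℂ zetaOne := differentiable_zetaOne
  have h12 : DifferentiableAt ℂ (fun s₂ => zetaOne (s₁ + s₂)) s₂ :=
    (hW _).comp s₂ ((differentiableAt_const s₁).add differentiableAt_id)
  unfold lemma3D
  refine ((hGd.mul (h12.pow d)).div (((differentiableAt_const _).pow a).mul ((hW s₂).pow b))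
    ?_).differentiableWithinAt
  exact mul_ne_zero (pow_ne_zero _ hW1) (pow_ne_zero _ hW2)

/-- **`D` is Lipschitz at the origin** (Cauchy's estimate on circles of radius `ρ` + the mean value
inequality): for `‖s₁‖, ‖s₂‖ < ρ`,
`|D(s₁,s₂) − D(0,0)| ≤ (B (3/2)^d 2^a 2^b / ρ) (‖s₁‖ + ‖s₂‖)`,
provided `6ρ ≤ ρ_W`, `3ρ < 1/4` and `|G| ≤ B` on `‖sᵢ‖ ≤ 2ρ`.
[cite: GoldstonPintzYildirim2009, Section 8, Lemma 3 proof] -/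
theorem norm_lemma3D_sub_zero_le (hG : DifferentiableOn ℂ (fun z : ℂ × ℂ => G z.1 z.2) G₂Region)
    {ρW ρ B : ℝ} (hρ : ∀ s : ℂ, ‖s‖ ≤ ρW → 1 / 2 ≤ ‖zetaOne s‖ ∧ ‖zetaOne s‖ ≤ 3 / 2)
    (hρ0 : 0 < ρ) (h6ρ : 6 * ρ ≤ ρW) (hρ4 : 3 * ρ < 1 / 4) (hB0 : 0 ≤ B)
    (hGB : ∀ s₁ s₂ : ℂ, ‖s₁‖ ≤ 2 * ρ → ‖s₂‖ ≤ 2 * ρ → ‖G s₁ s₂‖ ≤ B) (a b d : ℕ) {s₁ s₂ : ℂ}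
    (h1 : ‖s₁‖ < ρ) (h2 : ‖s₂‖ < ρ) :
    ‖lemma3D G a b d s₁ s₂ - lemma3D G a b d 0 0‖ ≤
      B * (3 / 2) ^ d * 2 ^ a * 2 ^ b / ρ * (‖s₁‖ + ‖s₂‖) := by
  set M : ℝ := B * (3 / 2) ^ d * 2 ^ a * 2 ^ b with hM
  have hM0 : 0 ≤ M := by positivity
  have h4ρ : 4 * ρ ≤ ρW := by linarith
  -- derivative bounds on `ball 0 ρ` for the two partial functions
  have hderiv : ∀ (f : ℂ → ℂ), DifferentiableOn ℂ f (Metric.ball 0 (3 * ρ)) →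
      (∀ z : ℂ, ‖z‖ ≤ 2 * ρ → ‖f z‖ ≤ M) → ∀ x ∈ Metric.ball (0 : ℂ) ρ, ‖deriv f x‖ ≤ M / ρ := by
    intro f hf hfM x hx
    rw [Metric.mem_ball, dist_zero_right] at hx
    refine Complex.norm_deriv_le_of_forall_mem_sphere_norm_le hρ0 ?_ ?_
    · refine hf.diffContOnCl_ball (fun z hz => ?_)
      rw [Metric.mem_closedBall, dist_eq_norm] at hz
      rw [Metric.mem_ball, dist_zero_right]
      have := norm_sub_norm_le z x
      linarith
    · intro z hz
      rw [Metric.mem_sphere, dist_eq_norm] at hz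
      refine hfM z ?_
      have := norm_sub_norm_le z x
      linarith
  have hlip : ∀ (f : ℂ → ℂ), DifferentiableOn ℂ f (Metric.ball 0 (3 * ρ)) →
      (∀ z : ℂ, ‖z‖ ≤ 2 * ρ → ‖f z‖ ≤ M) → ∀ y : ℂ, ‖y‖ < ρ → ‖f y - f 0‖ ≤ M / ρ * ‖y‖ := by
    intro f hf hfM y hy
    have h := Convex.norm_image_sub_le_of_norm_deriv_le (𝕜 := ℂ) (f := f) (s := Metric.ball (0 : ℂ) ρ)
      (fun x hx => hf.differentiableAt (Metric.isOpen_ball.mem_nhds (by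
        rw [Metric.mem_ball, dist_zero_right] at hx ⊢; linarith)))
      (hderiv f hf hfM) (convex_ball 0 ρ) (Metric.mem_ball_self hρ0)
      (by rwa [Metric.mem_ball, dist_zero_right])
    rwa [sub_zero] at h
  -- apply to `D(·, s₂)` and `D(0, ·)`
  have hf1 := hlip (fun z => lemma3D G a b d z s₂)
    (differentiableOn_lemma3D_fst hG hρ h6ρ hρ4 a b d (by linarith))
    (fun z hz => norm_lemma3D_le_of_small hρ h4ρ hB0 hGB a b d hz (by linarith)) s₁ h1
  have hf2 := hlip (fun w => lemma3D G a b d 0 w)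
    (differentiableOn_lemma3D_snd hG hρ h6ρ hρ4 a b d (by simpa using by linarith : ‖(0 : ℂ)‖ < 3 * ρ))
    (fun w hw => norm_lemma3D_le_of_small hρ h4ρ hB0 hGB a b d (by simpa using by linarith : ‖(0 : ℂ)‖ ≤ 2 * ρ) hw) s₂ h2
  calc ‖lemma3D G a b d s₁ s₂ - lemma3D G a b d 0 0‖
      = ‖(lemma3D G a b d s₁ s₂ - lemma3D G a b d 0 s₂) + (lemma3D G a b d 0 s₂ - lemma3D G a b d 0 0)‖ := by
        ring_nf
    _ ≤ ‖lemma3D G a b d s₁ s₂ - lemma3D G a b d 0 s₂‖ + ‖lemma3D G a b d 0 s₂ - lemma3D G a b d 0 0‖ :=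
        norm_add_le _ _
    _ ≤ M / ρ * ‖s₁‖ + M / ρ * ‖s₂‖ := add_le_add hf1 hf2
    _ = M / ρ * (‖s₁‖ + ‖s₂‖) := by ring

/-! ### The model inner residue in closed form, and the perturbation -/

/-- `A(s₂) = ∮_{∂Q(0,η)} K(s₁,s₂) ds₁`, the inner residue of the model kernel.
[cite: GoldstonPintzYildirim2009, Section 8 eq. 8.9] -/
def modelInner (L : ℂ) (d u v : ℕ) (η : ℝ) (s₂ : ℂ) : ℂ :=
  rectBoundaryIntegral (fun s₁ => modelKernel L d u v s₁ s₂) (-η) η (-η) η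

/-- `P(s₂) = ∮_{∂Q(0,η)} (F(s₁,s₂) − D(0,0) K(s₁,s₂)) ds₁`, the inner residue of the perturbation.
[cite: GoldstonPintzYildirim2009, Section 8, Lemma 3 proof] -/
def pertInner (G : ℂ → ℂ → ℂ) (R : ℝ) (a b d u v : ℕ) (η : ℝ) (s₂ : ℂ) : ℂ :=
  rectBoundaryIntegral (fun s₁ => lemma3F G R a b d u v s₁ s₂ -
    lemma3D G a b d 0 0 * modelKernel (Real.log R) d u v s₁ s₂) (-η) η (-η) η

/-- **Closed form of the model inner residue** (`η > 0`, `s₂` with a coordinate `> η` in absolute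
value): `A(s₂) = e^{Ls₂} s₂^{−(v+1)} · 2πi ∑_{i≤u} (−1)^i C(d+i−1,i) s₂^{−d−i} L^{u−i}/(u−i)!`.
[cite: GoldstonPintzYildirim2009, Section 8 eq. 8.9] -/
theorem modelInner_eq {η : ℝ} (hη : 0 < η) (L : ℂ) (d u v : ℕ) {s₂ : ℂ}
    (hs₂ : η < |s₂.re| ∨ η < |s₂.im|) :
    modelInner L d u v η s₂ = cexp (L * s₂) * (s₂ ^ (v + 1))⁻¹ *
      (2 * Real.pi * I * ∑ i ∈ Finset.range (u + 1),
        (-1) ^ i * ((d + i - 1).choose i : ℂ) * s₂ ^ (-(d : ℤ) - i) *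
          (L ^ (u - i) / ((u - i).factorial : ℂ))) := by
  unfold modelInner modelKernel
  have hfun : (fun s₁ => cexp (L * (s₁ + s₂)) / (s₁ ^ (u + 1) * s₂ ^ (v + 1) * (s₁ + s₂) ^ d)) =
      fun s₁ => cexp (L * s₂) * (s₂ ^ (v + 1))⁻¹ *
        ((s₁ + s₂) ^ (-(d : ℤ)) * cexp (L * s₁) / s₁ ^ (u + 1)) :=
    funext fun s₁ => Literature.Analysis.Complex.exp_mul_add_div_eq L u v d s₁ s₂
  rw [hfun, Literature.Analysis.Complex.rectBoundaryIntegral_const_mul,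
    Literature.Analysis.Complex.rectBoundaryIntegral_add_zpow_neg_mul_exp_div_pow hη hs₂ L d u]

/-- The set of `s₂` with a coordinate of absolute value `> η` is open. [folklore] -/
theorem isOpen_supNorm_gt (η : ℝ) : IsOpen {s : ℂ | η < |s.re| ∨ η < |s.im|} :=
  (isOpen_lt continuous_const (continuous_abs.comp Complex.continuous_re)).union
    (isOpen_lt continuous_const (continuous_abs.comp Complex.continuous_im))

/-- **`A` is continuous** at every `s₂` with a coordinate of absolute value `> η` (`η > 0`).
[cite: GoldstonPintzYildirim2009, Section 8 eq. 8.9] -/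
theorem continuousAt_modelInner {η : ℝ} (hη : 0 < η) (L : ℂ) (d u v : ℕ) {s₂ : ℂ}
    (hs₂ : η < |s₂.re| ∨ η < |s₂.im|) : ContinuousAt (modelInner L d u v η) s₂ := by
  have hs0 : ∀ s : ℂ, (η < |s.re| ∨ η < |s.im|) → s ≠ 0 := by
    rintro s hs rfl
    simp only [zero_re, abs_zero, zero_im, or_self] at hs
    linarith
  set g : ℂ → ℂ := fun s => cexp (L * s) * (s ^ (v + 1))⁻¹ *
      (2 * Real.pi * I * ∑ i ∈ Finset.range (u + 1),
        (-1) ^ i * ((d + i - 1).choose i : ℂ) * s ^ (-(d : ℤ) - i) *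
          (L ^ (u - i) / ((u - i).factorial : ℂ))) with hg
  have hgc : ContinuousOn g {s : ℂ | s ≠ 0} := by
    refine (((by fun_prop : Continuous fun s : ℂ => cexp (L * s)).continuousOn).mul
      ((continuousOn_pow _).inv₀ (fun s hs => pow_ne_zero _ hs))).mul
      (continuousOn_const.mul (continuousOn_finsetSum _ (fun i _ => ?_)))
    exact (continuousOn_const.mul (continuousOn_id.zpow₀ _ (fun s hs => Or.inl hs))).mul
      continuousOn_const
  have hga : ContinuousAt g s₂ := hgc.continuousAt (isOpen_ne.mem_nhds (hs0 s₂ hs₂))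
  have heq : g =ᶠ[𝓝 s₂] modelInner L d u v η := by
    filter_upwards [(isOpen_supNorm_gt η).mem_nhds hs₂] with s hs
    rw [hg, modelInner_eq hη L d u v hs]
  exact hga.congr heq

/-- The model kernel is continuous in `s₁` at every `s₁ ≠ 0` with `s₁ + s₂ ≠ 0` (`s₂ ≠ 0`).
[folklore] -/
theorem continuousAt_modelKernel (L : ℂ) (d u v : ℕ) {s₁ s₂ : ℂ} (h1 : s₁ ≠ 0) (h2 : s₂ ≠ 0)
    (h12 : s₁ + s₂ ≠ 0) : ContinuousAt (fun s₁ => modelKernel L d u v s₁ s₂) s₁ := by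
  unfold modelKernel
  have hden : s₁ ^ (u + 1) * s₂ ^ (v + 1) * (s₁ + s₂) ^ d ≠ 0 :=
    mul_ne_zero (mul_ne_zero (pow_ne_zero _ h1) (pow_ne_zero _ h2)) (pow_ne_zero _ h12)
  exact ContinuousAt.div (by fun_prop) (by fun_prop) hden

/-- **Inner split**: for `s₂ ∈ zeroResDomain η` (`0 < η < 1/8`, `2η ≤ ρ_W`, `R > 0`),
`ρ₀(s₂) = D(0,0) A(s₂) + P(s₂)`. [cite: GoldstonPintzYildirim2009, Section 8, Lemma 3 proof] -/
theorem zeroRes_eq_add (hG : DifferentiableOn ℂ (fun z : ℂ × ℂ => G z.1 z.2) G₂Region)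
    {ρW : ℝ} (hρ : ∀ s : ℂ, ‖s‖ ≤ ρW → 1 / 2 ≤ ‖zetaOne s‖ ∧ ‖zetaOne s‖ ≤ 3 / 2)
    {R : ℝ} (hR : 0 < R) (a b d u v : ℕ) {η : ℝ} (hη : 0 < η) (hη8 : η < 1 / 8) (hηρ : 2 * η ≤ ρW)
    {s₂ : ℂ} (hs₂ : s₂ ∈ zeroResDomain η) :
    zeroRes G R a b d u v η s₂ =
      lemma3D G a b d 0 0 * modelInner (Real.log R) d u v η s₂ + pertInner G R a b d u v η s₂ := by
  -- continuity of the two summands at boundary points of `Q(0,η)`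
  have hbd : ∀ z : ℂ, ((z.re ∈ Icc (-η) η ∧ (z.im = -η ∨ z.im = η)) ∨
      (z.im ∈ Icc (-η) η ∧ (z.re = -η ∨ z.re = η))) → z ∈ squareShell η := by
    rintro z (⟨hre, him | him⟩ | ⟨him, hre | hre⟩)
    · exact ⟨abs_le.2 ⟨hre.1, hre.2⟩, by rw [him, abs_neg, abs_of_pos hη],
        Or.inr (by rw [him, abs_neg, abs_of_pos hη]; linarith)⟩
    · exact ⟨abs_le.2 ⟨hre.1, hre.2⟩, by rw [him, abs_of_pos hη],
        Or.inr (by rw [him, abs_of_pos hη]; linarith)⟩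
    · exact ⟨by rw [hre, abs_neg, abs_of_pos hη], abs_le.2 ⟨him.1, him.2⟩,
        Or.inl (by rw [hre, abs_neg, abs_of_pos hη]; linarith)⟩
    · exact ⟨by rw [hre, abs_of_pos hη], abs_le.2 ⟨him.1, him.2⟩,
        Or.inl (by rw [hre, abs_of_pos hη]; linarith)⟩
  have hK : ∀ z ∈ squareShell η, ContinuousAt
      (fun s₁ => lemma3D G a b d 0 0 * modelKernel (Real.log R) d u v s₁ s₂) z := by
    intro z hz
    obtain ⟨-, -, -, -, hs1ne, hs2ne, hs12⟩ := mem_lemma3Good_of_shell hρ hη hη8 hηρ hz hs₂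
    exact (continuousAt_modelKernel _ d u v hs1ne hs2ne hs12).const_mul _
  have hF : ∀ z ∈ squareShell η, ContinuousAt (fun s₁ => lemma3F G R a b d u v s₁ s₂) z := by
    intro z hz
    obtain ⟨h1, h2, hW1, hW2, hs1ne, hs2ne, hs12⟩ := mem_lemma3Good_of_shell hρ hη hη8 hηρ hz hs₂
    exact (differentiableAt_lemma3F_fst hG hR a b d u v h1 h2 hW1 hW2 hs1ne hs2ne hs12).continuousAt
  have hP : ∀ z ∈ squareShell η, ContinuousAt (fun s₁ => lemma3F G R a b d u v s₁ s₂ -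
      lemma3D G a b d 0 0 * modelKernel (Real.log R) d u v s₁ s₂) z :=
    fun z hz => (hF z hz).sub (hK z hz)
  have hsplit : zeroRes G R a b d u v η s₂ = rectBoundaryIntegral (fun s₁ =>
      lemma3D G a b d 0 0 * modelKernel (Real.log R) d u v s₁ s₂ +
        (lemma3F G R a b d u v s₁ s₂ - lemma3D G a b d 0 0 * modelKernel (Real.log R) d u v s₁ s₂))
      (-η) η (-η) η := by
    unfold zeroRes; congr 1; funext s₁; ring
  rw [hsplit, Literature.Analysis.Complex.rectBoundaryIntegral_add (by linarith) (by linarith)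
    (fun x hx => hK _ (hbd _ (Or.inl ⟨by simpa using hx, Or.inl (by simp)⟩)))
    (fun x hx => hK _ (hbd _ (Or.inl ⟨by simpa using hx, Or.inr (by simp)⟩)))
    (fun y hy => hK _ (hbd _ (Or.inr ⟨by simpa using hy, Or.inl (by simp)⟩)))
    (fun y hy => hK _ (hbd _ (Or.inr ⟨by simpa using hy, Or.inr (by simp)⟩)))
    (fun x hx => hP _ (hbd _ (Or.inl ⟨by simpa using hx, Or.inl (by simp)⟩)))
    (fun x hx => hP _ (hbd _ (Or.inl ⟨by simpa using hx, Or.inr (by simp)⟩)))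
    (fun y hy => hP _ (hbd _ (Or.inr ⟨by simpa using hy, Or.inl (by simp)⟩)))
    (fun y hy => hP _ (hbd _ (Or.inr ⟨by simpa using hy, Or.inr (by simp)⟩))),
    Literature.Analysis.Complex.rectBoundaryIntegral_const_mul]
  rfl

/-- **Outer split — the main term**: with `0 < η < η′`, `2η′ < 1/4`... precisely `η < 1/8`,
`4η′ ≤ ρ_W`, `η′ < 1/4`, `R > 0`:
`∮_{∂Q(0,η′)} ρ₀ = D(0,0) · (2πi)² C(u+v,u) (log R)^{u+v+d}/(u+v+d)! + ∮_{∂Q(0,η′)} P`.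
The first term is GPY's main term (8.13) (times `(2πi)²`), by
`Literature.Analysis.Complex.rectBoundaryIntegral_rectBoundaryIntegral_exp_div`.
[cite: GoldstonPintzYildirim2009, Section 8 eq. 8.13] -/
theorem rectBoundaryIntegral_zeroRes_eq (hG : DifferentiableOn ℂ (fun z : ℂ × ℂ => G z.1 z.2) G₂Region)
    {ρW : ℝ} (hρ : ∀ s : ℂ, ‖s‖ ≤ ρW → 1 / 2 ≤ ‖zetaOne s‖ ∧ ‖zetaOne s‖ ≤ 3 / 2)
    {R : ℝ} (hR : 0 < R) (a b d u v : ℕ) {η η' : ℝ} (hη : 0 < η) (hη8 : η < 1 / 8) (hηη' : η < η')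
    (hη'ρ : 4 * η' ≤ ρW) (hη'4 : η' < 1 / 4) :
    rectBoundaryIntegral (zeroRes G R a b d u v η) (-η') η' (-η') η' =
      lemma3D G a b d 0 0 * ((2 * Real.pi * I) ^ 2 * ((((u + v).choose u : ℕ) : ℂ) *
        (Real.log R : ℂ) ^ (u + v + d) / ((u + v + d).factorial : ℂ))) +
      rectBoundaryIntegral (pertInner G R a b d u v η) (-η') η' (-η') η' := by
  have hηρ : 2 * η ≤ ρW := by linarith
  have hne : ∀ s : ℂ, ‖s‖ ≤ ρW → zetaOne s ≠ 0 := fun s hs h => by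
    have := (hρ s hs).1; rw [h, norm_zero] at this; linarith
  -- boundary points of `Q(0,η')` lie in `zeroResDomain η` with a coordinate `> η`
  have hmem : ∀ z : ℂ, ((z.re ∈ Icc (-η') η' ∧ (z.im = -η' ∨ z.im = η')) ∨
      (z.im ∈ Icc (-η') η' ∧ (z.re = -η' ∨ z.re = η'))) →
      z ∈ zeroResDomain η ∧ (η < |z.re| ∨ η < |z.im|) := by
    intro z hz
    obtain ⟨hlo, hhi, hre, him⟩ := square_boundary_norms (by linarith : 0 < η') hz
    have hsup : η < |z.re| ∨ η < |z.im| := by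
      rcases hz with ⟨_, h | h⟩ | ⟨_, h | h⟩
      · right; rw [h, abs_neg, abs_of_pos (by linarith : (0:ℝ) < η')]; exact hηη'
      · right; rw [h, abs_of_pos (by linarith : (0:ℝ) < η')]; exact hηη'
      · left; rw [h, abs_neg, abs_of_pos (by linarith : (0:ℝ) < η')]; exact hηη'
      · left; rw [h, abs_of_pos (by linarith : (0:ℝ) < η')]; exact hηη'
    refine ⟨⟨by linarith [(abs_le.1 hre).1], hne z (by linarith), hsup⟩, hsup⟩
  -- replace `ρ₀` by `D(0,0) A + P` on the boundary
  have hcongr : rectBoundaryIntegral (zeroRes G R a b d u v η) (-η') η' (-η') η' =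
      rectBoundaryIntegral (fun s₂ => lemma3D G a b d 0 0 * modelInner (Real.log R) d u v η s₂ +
        pertInner G R a b d u v η s₂) (-η') η' (-η') η' := by
    refine Literature.Analysis.Complex.rectBoundaryIntegral_congr (by linarith) (by linarith) ?_ ?_ ?_ ?_
    · intro x hx; exact zeroRes_eq_add hG hρ hR a b d u v hη hη8 hηρ
        (hmem _ (Or.inl ⟨by simpa using hx, Or.inl (by simp)⟩)).1
    · intro x hx; exact zeroRes_eq_add hG hρ hR a b d u v hη hη8 hηρ
        (hmem _ (Or.inl ⟨by simpa using hx, Or.inr (by simp)⟩)).1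
    · intro y hy; exact zeroRes_eq_add hG hρ hR a b d u v hη hη8 hηρ
        (hmem _ (Or.inr ⟨by simpa using hy, Or.inl (by simp)⟩)).1
    · intro y hy; exact zeroRes_eq_add hG hρ hR a b d u v hη hη8 hηρ
        (hmem _ (Or.inr ⟨by simpa using hy, Or.inr (by simp)⟩)).1
  -- continuity of the two summands at the boundary points
  have hA : ∀ z : ℂ, ((z.re ∈ Icc (-η') η' ∧ (z.im = -η' ∨ z.im = η')) ∨
      (z.im ∈ Icc (-η') η' ∧ (z.re = -η' ∨ z.re = η'))) →
      ContinuousAt (fun s₂ => lemma3D G a b d 0 0 * modelInner (Real.log R) d u v η s₂) z :=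
    fun z hz => (continuousAt_modelInner hη _ d u v (hmem z hz).2).const_mul _
  have hPc : ∀ z : ℂ, ((z.re ∈ Icc (-η') η' ∧ (z.im = -η' ∨ z.im = η')) ∨
      (z.im ∈ Icc (-η') η' ∧ (z.re = -η' ∨ z.re = η'))) →
      ContinuousAt (pertInner G R a b d u v η) z := by
    intro z hz
    obtain ⟨hzU, hzsup⟩ := hmem z hz
    -- near `z`, `P = ρ₀ − D(0,0) A`, both continuous at `z`
    have hρ₀ : ContinuousAt (zeroRes G R a b d u v η) z :=
      ((differentiableOn_zeroRes hG hρ hR a b d u v hη hη8 hηρ).differentiableAt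
        ((isOpen_zeroResDomain η).mem_nhds hzU)).continuousAt
    have hdiff : ContinuousAt (fun s₂ => zeroRes G R a b d u v η s₂ -
        lemma3D G a b d 0 0 * modelInner (Real.log R) d u v η s₂) z := hρ₀.sub (hA z hz)
    refine hdiff.congr ?_
    filter_upwards [(isOpen_zeroResDomain η).mem_nhds hzU] with s hs
    rw [zeroRes_eq_add hG hρ hR a b d u v hη hη8 hηρ hs]
    ring
  rw [hcongr, Literature.Analysis.Complex.rectBoundaryIntegral_add (by linarith) (by linarith)
    (fun x hx => hA _ (Or.inl ⟨by simpa using hx, Or.inl (by simp)⟩))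
    (fun x hx => hA _ (Or.inl ⟨by simpa using hx, Or.inr (by simp)⟩))
    (fun y hy => hA _ (Or.inr ⟨by simpa using hy, Or.inl (by simp)⟩))
    (fun y hy => hA _ (Or.inr ⟨by simpa using hy, Or.inr (by simp)⟩))
    (fun x hx => hPc _ (Or.inl ⟨by simpa using hx, Or.inl (by simp)⟩))
    (fun x hx => hPc _ (Or.inl ⟨by simpa using hx, Or.inr (by simp)⟩))
    (fun y hy => hPc _ (Or.inr ⟨by simpa using hy, Or.inl (by simp)⟩))
    (fun y hy => hPc _ (Or.inr ⟨by simpa using hy, Or.inr (by simp)⟩)),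
    Literature.Analysis.Complex.rectBoundaryIntegral_const_mul]
  congr 2
  exact Literature.Analysis.Complex.rectBoundaryIntegral_rectBoundaryIntegral_exp_div hη hηη' _ u v d

/-! ### The perturbation is small -/

/-- Norm of the model kernel: `|K(s₁,s₂)| = e^{L·Re(s₁+s₂)}/(|s₁|^{u+1}|s₂|^{v+1}|s₁+s₂|^d)` (`L` real).
[folklore] -/
theorem norm_modelKernel (L : ℝ) (d u v : ℕ) (s₁ s₂ : ℂ) :
    ‖modelKernel L d u v s₁ s₂‖ =
      Real.exp (L * (s₁.re + s₂.re)) / (‖s₁‖ ^ (u + 1) * ‖s₂‖ ^ (v + 1) * ‖s₁ + s₂‖ ^ d) := by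
  unfold modelKernel
  rw [norm_div, norm_mul, norm_mul, norm_pow, norm_pow, norm_pow, Complex.norm_exp]
  congr 2
  simp [Complex.mul_re]

/-- **Pointwise bound for the perturbation integrand** on `∂Q(0,η) × ∂Q(0,η′)`:
for `η ≤ |s₁| ≤ 2η`, `η′ ≤ |s₂| ≤ 2η′`, `|Re s₁| ≤ η`, `|Re s₂| ≤ η′`, with `2η < η′`, `2η′ < ρ`,
`6ρ ≤ ρ_W`, `3ρ < 1/4`, `|G| ≤ B` on `‖sᵢ‖ ≤ 2ρ`, `L = log R ≥ 0`:
`|F − D(0,0)K| ≤ (B(3/2)^d 2^a 2^b/ρ)(2η+2η′) e^{L(η+η′)} / (η^{u+1} η′^{v+1} (η′−2η)^d)`.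
[cite: GoldstonPintzYildirim2009, Section 8, Lemma 3 proof] -/
theorem norm_pert_integrand_le (hG : DifferentiableOn ℂ (fun z : ℂ × ℂ => G z.1 z.2) G₂Region)
    {ρW ρ B : ℝ} (hρ : ∀ s : ℂ, ‖s‖ ≤ ρW → 1 / 2 ≤ ‖zetaOne s‖ ∧ ‖zetaOne s‖ ≤ 3 / 2)
    (hρ0 : 0 < ρ) (h6ρ : 6 * ρ ≤ ρW) (hρ4 : 3 * ρ < 1 / 4) (hB0 : 0 ≤ B)
    (hGB : ∀ s₁ s₂ : ℂ, ‖s₁‖ ≤ 2 * ρ → ‖s₂‖ ≤ 2 * ρ → ‖G s₁ s₂‖ ≤ B) {R : ℝ} (hR : 1 ≤ R)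
    (a b d u v : ℕ) {η η' : ℝ} (hη : 0 < η) (hηη' : 2 * η < η') (hη'ρ : 2 * η' < ρ) {s₁ s₂ : ℂ}
    (h1lo : η ≤ ‖s₁‖) (h1hi : ‖s₁‖ ≤ 2 * η) (h1re : |s₁.re| ≤ η)
    (h2lo : η' ≤ ‖s₂‖) (h2hi : ‖s₂‖ ≤ 2 * η') (h2re : |s₂.re| ≤ η') :
    ‖lemma3F G R a b d u v s₁ s₂ - lemma3D G a b d 0 0 * modelKernel (Real.log R) d u v s₁ s₂‖ ≤
      B * (3 / 2) ^ d * 2 ^ a * 2 ^ b / ρ * (2 * η + 2 * η') * Real.exp (Real.log R * (η + η')) /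
        (η ^ (u + 1) * η' ^ (v + 1) * (η' - 2 * η) ^ d) := by
  have hR0 : 0 < R := by linarith
  have hL0 : 0 ≤ Real.log R := Real.log_nonneg hR
  have hη' : 0 < η' := by linarith
  rw [lemma3F_eq_lemma3D_mul_modelKernel hR0, ← sub_mul, norm_mul]
  have hD := norm_lemma3D_sub_zero_le hG hρ hρ0 h6ρ hρ4 hB0 hGB a b d (s₁ := s₁) (s₂ := s₂)
    (by linarith) (by linarith)
  have hM0 : 0 ≤ B * (3 / 2) ^ d * 2 ^ a * 2 ^ b / ρ := by positivity
  have hD' : ‖lemma3D G a b d s₁ s₂ - lemma3D G a b d 0 0‖ ≤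
      B * (3 / 2) ^ d * 2 ^ a * 2 ^ b / ρ * (2 * η + 2 * η') :=
    hD.trans (mul_le_mul_of_nonneg_left (by linarith) hM0)
  -- the kernel
  have h12 : η' - 2 * η ≤ ‖s₁ + s₂‖ := by
    have h := norm_sub_norm_le s₂ (-s₁)
    rw [norm_neg, sub_neg_eq_add, add_comm s₂ s₁] at h
    linarith
  have hgap : 0 < η' - 2 * η := by linarith
  have hK : ‖modelKernel (Real.log R) d u v s₁ s₂‖ ≤
      Real.exp (Real.log R * (η + η')) / (η ^ (u + 1) * η' ^ (v + 1) * (η' - 2 * η) ^ d) := by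
    rw [norm_modelKernel]
    have hnum : Real.exp (Real.log R * (s₁.re + s₂.re)) ≤ Real.exp (Real.log R * (η + η')) := by
      refine Real.exp_le_exp.2 (mul_le_mul_of_nonneg_left ?_ hL0)
      linarith [le_abs_self s₁.re, le_abs_self s₂.re]
    have hden : η ^ (u + 1) * η' ^ (v + 1) * (η' - 2 * η) ^ d ≤
        ‖s₁‖ ^ (u + 1) * ‖s₂‖ ^ (v + 1) * ‖s₁ + s₂‖ ^ d := by
      gcongr
    calc Real.exp (Real.log R * (s₁.re + s₂.re)) / (‖s₁‖ ^ (u + 1) * ‖s₂‖ ^ (v + 1) * ‖s₁ + s₂‖ ^ d)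
        ≤ Real.exp (Real.log R * (η + η')) / (‖s₁‖ ^ (u + 1) * ‖s₂‖ ^ (v + 1) * ‖s₁ + s₂‖ ^ d) :=
          div_le_div_of_nonneg_right hnum (by positivity)
      _ ≤ Real.exp (Real.log R * (η + η')) / (η ^ (u + 1) * η' ^ (v + 1) * (η' - 2 * η) ^ d) :=
          div_le_div_of_nonneg_left (by positivity) (by positivity) hden
  rw [mul_div_assoc]
  exact mul_le_mul hD' hK (norm_nonneg _) (by positivity)

/-- **The perturbation term is small**:
`|∮_{∂Q(0,η′)} P| ≤ 8η′ · 8η · (B(3/2)^d 2^a 2^b/ρ)(2η+2η′) e^{L(η+η′)}/(η^{u+1} η′^{v+1} (η′−2η)^d)`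
(hypotheses as in `norm_pert_integrand_le`). With `η ≍ η′ ≍ 1/log R` and `ρ = 1/log log R` this is
`≪ B (log R)^{u+v+d−1} log log R`. [cite: GoldstonPintzYildirim2009, Section 8, Lemma 3 proof] -/
theorem norm_rectBoundaryIntegral_pertInner_le
    (hG : DifferentiableOn ℂ (fun z : ℂ × ℂ => G z.1 z.2) G₂Region)
    {ρW ρ B : ℝ} (hρ : ∀ s : ℂ, ‖s‖ ≤ ρW → 1 / 2 ≤ ‖zetaOne s‖ ∧ ‖zetaOne s‖ ≤ 3 / 2)
    (hρ0 : 0 < ρ) (h6ρ : 6 * ρ ≤ ρW) (hρ4 : 3 * ρ < 1 / 4) (hB0 : 0 ≤ B)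
    (hGB : ∀ s₁ s₂ : ℂ, ‖s₁‖ ≤ 2 * ρ → ‖s₂‖ ≤ 2 * ρ → ‖G s₁ s₂‖ ≤ B) {R : ℝ} (hR : 1 ≤ R)
    (a b d u v : ℕ) {η η' : ℝ} (hη : 0 < η) (hηη' : 2 * η < η') (hη'ρ : 2 * η' < ρ) :
    ‖rectBoundaryIntegral (pertInner G R a b d u v η) (-η') η' (-η') η'‖ ≤
      8 * η' * (8 * η * (B * (3 / 2) ^ d * 2 ^ a * 2 ^ b / ρ * (2 * η + 2 * η') *
        Real.exp (Real.log R * (η + η')) / (η ^ (u + 1) * η' ^ (v + 1) * (η' - 2 * η) ^ d))) := by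
  have hη' : 0 < η' := by linarith
  set M : ℝ := B * (3 / 2) ^ d * 2 ^ a * 2 ^ b / ρ * (2 * η + 2 * η') *
    Real.exp (Real.log R * (η + η')) / (η ^ (u + 1) * η' ^ (v + 1) * (η' - 2 * η) ^ d) with hM
  -- inner bound, for `s₂` on `∂Q(0,η')`
  have hinner : ∀ s₂ : ℂ, ((s₂.re ∈ Icc (-η') η' ∧ (s₂.im = -η' ∨ s₂.im = η')) ∨
      (s₂.im ∈ Icc (-η') η' ∧ (s₂.re = -η' ∨ s₂.re = η'))) →
      ‖pertInner G R a b d u v η s₂‖ ≤ 8 * η * M := by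
    intro s₂ hs₂
    obtain ⟨h2lo, h2hi, h2re, -⟩ := square_boundary_norms hη' hs₂
    have hpt : ∀ s₁ : ℂ, ((s₁.re ∈ Icc (-η) η ∧ (s₁.im = -η ∨ s₁.im = η)) ∨
        (s₁.im ∈ Icc (-η) η ∧ (s₁.re = -η ∨ s₁.re = η))) →
        ‖lemma3F G R a b d u v s₁ s₂ - lemma3D G a b d 0 0 * modelKernel (Real.log R) d u v s₁ s₂‖ ≤ M := by
      intro s₁ hs₁
      obtain ⟨h1lo, h1hi, h1re, -⟩ := square_boundary_norms hη hs₁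
      exact norm_pert_integrand_le hG hρ hρ0 h6ρ hρ4 hB0 hGB hR a b d u v hη hηη' hη'ρ h1lo h1hi h1re
        h2lo h2hi h2re
    have h := Literature.Analysis.Complex.norm_rectBoundaryIntegral_le
      (F := fun s₁ => lemma3F G R a b d u v s₁ s₂ - lemma3D G a b d 0 0 * modelKernel (Real.log R) d u v s₁ s₂)
      (a := -η) (b := η) (c := -η) (d := η) (by linarith) (by linarith)
      (fun x hx => hpt _ (Or.inl ⟨by simpa using hx, Or.inl (by simp)⟩))
      (fun x hx => hpt _ (Or.inl ⟨by simpa using hx, Or.inr (by simp)⟩))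
      (fun y hy => hpt _ (Or.inr ⟨by simpa using hy, Or.inl (by simp)⟩))
      (fun y hy => hpt _ (Or.inr ⟨by simpa using hy, Or.inr (by simp)⟩))
    unfold pertInner
    refine h.trans (le_of_eq ?_)
    ring
  have h := Literature.Analysis.Complex.norm_rectBoundaryIntegral_le (F := pertInner G R a b d u v η)
    (a := -η') (b := η') (c := -η') (d := η') (by linarith) (by linarith)
    (fun x hx => hinner _ (Or.inl ⟨by simpa using hx, Or.inl (by simp)⟩))
    (fun x hx => hinner _ (Or.inl ⟨by simpa using hx, Or.inr (by simp)⟩))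
    (fun y hy => hinner _ (Or.inr ⟨by simpa using hy, Or.inl (by simp)⟩))
    (fun y hy => hinner _ (Or.inr ⟨by simpa using hy, Or.inr (by simp)⟩))
  refine h.trans (le_of_eq ?_)
  ring

end Outer

end Literature.NumberTheory.Sieve.GPY
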